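import Summits.Schanuel.Schanuel.Theorems.RootDecomp1KSiegelFunctions04

/-!
# RootDecomp1KSiegelFunctions — lens 1, generation 71, NODE 31 «THE HEIGHT BINDER HALVED: `HeightComparison ⟸ SiegelFunctionsAll`, ARITHMETIC HALF PROVED» (×0-AS-RECORD + one contingent ×1 at FLOOR G (a) — PRICE 31 L3149, RULING L3160, NODE L3172, VERDICT L3175): the node-12 hypothesis binder `HeightComparison` (Weil–Siegel height comparison on a plane curve) is, definitionally, `∀ P, GeomIrreducible P → 1 ≤ xdeg P → 1 ≤ deg_Y P → HeightComparisonAt P`, and `heightComparisonAt_of_siegelFunctions` PROVES `HeightComparisonAt P` from the GEOMETRIC datum `SiegelFunctions P ∧ SiegelFunctions (swap P)` (two integral functions of controlled degree for every b ≥ 1); the ARITHMETIC half (rational-root integrality, archimedean root bound, `h(y^b) = b·h(y)`, finite exceptional fibres by Bezout, exchange of variables) is proved sorry-free; hence `heightComparison_of_siegelFunctionsAll : SiegelFunctionsAll → HeightComparison` and the node-12 heads re-pointed BY NAME; the geometric half `SiegelFunctionsAll` is a typed HYPOTHESIS (plan S1–S6 in the docstring of `SiegelFunctions`), NOT proved;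 (G)-instances by hand: `parabP` / its transpose / `hyperbP`, and the infinite family 𝒞₃ = {(x·Y − 1)² − f(x) : f cubic, f(0) ≠ 1} in BOTH charts (Lucas trace; the 3 × 3 POWER LEMMA), its geometric irreducibility, and the HYPOTHESIS-FREE `heightComparisonAt_sqLinP` / `thinFibreAt_two_sqLinP` — ×0-AS-RECORD toolkit per RULING L3160 (every 𝒞₃ member is also decided by the numerator lever); `PadicSubspace`, items 33364 / 33363 / 31077 / 31987 and the tally UNMOVED — continuation (RootDecomp1KSiegelFunctions05): §6  RE-POINTING node 12 BY NAME (bookkeeping, ×0 — said so): THEOREM A localised to one curve, the K-line head · §7  SATISFIABILITY PROBES: the typed `∃` of `SiegelFunctions` PROVED BY HAND on three explicit curves of — 28 declarations `thinFibreAt_of_heightComparisonAt` … `siegelFunctions_toys`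

(lens-1 g71 NODE 31 «THE HEIGHT BINDER HALVED» L3172: HOME kernel K = HOME/decomp-schanuel-lens-1/g71/lean/SiegelFunctions.lean sha256 4f39c136…, 1983 l, 207 decls (173 theorems + 34 defs by the critic's count, VERDICT L3175; NODE's «208» an e-lite), ONE namespace `Summit.Schanuel.Schanuel.Theorems.RootDecomp1KSiegelFunctions` (inner anonymous-free sections `PowerLemma` / `Chart2` / `GeomIrreducible` with their `variable`s kept whole inside one part each), imports EXACTLY the tree port …RootDecomp1KHeightGrading02 (node 12: `HeightComparison`, `HeightDecidedAt`, `GeomIrreducible`, `logHt` BY TREE NAME) + `Literature.NumberTheory.DiophantineGeometry.PlaneCurveBezoutWeak` + `Mathlib.RingTheory.Polynomial.RationalRoot`; no private / instance / set_option / notation / sorry / new axiom / native_decide / [cite; lens farm rc 0 · 0 errors · 0 sorries · dupNamespace warnings only; `#print axioms` = [propext, Classical.choice, Quot.sound] on the nine probed heads (g71/out/ax_*.json), Probe g71/out/ProbeK.lean 2659bdec… rc 0 (rfl pin `HeightComparison` = tree), CONTROLS A / A0 / B rc 1 as designed (ctrlA 4ae3a6d6… / ctrlA0 ff875685… / ctrlB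 f20add70…), memo g71/NODE-g71.md 07fb49f8…, SHA256SUMS 34 files; CLAIM 31 L3146; crit PRICE 31 L3149 (×0-as-record + one contingent ×1 at FLOOR G; CHECKLIST K-g71; RULES K-R59 / K-R60 pre-announced); lens ASK-FIRST FAMILY CLAIM L3158 (𝒞₃) and crit RULING L3160 (𝒞₃ REFUSED as a FLOOR-G (b) family: numerator lever, NUMEXP; toolkit ×0 under K-R60 (i)); census INSTRUMENT NOTES 54–56 L3161 / L3163 / L3167 (LIVENESS-v46 / v47 / v48: rows 75–77 = 𝒞₃ members, keys numexp / numexp_tight / k60) and crit ACKs L3165 / L3168; writer NOTES 4 / 5 L3162 / L3173; crit-1 (g13) VERDICT 31 L3175: «NODE 31 = ×0-AS-RECORD BOOKED; CHECKLIST K-g71 (J1)–(J7) MET; the contingent THEOREM ×1 REGISTERED under K-R59 (ii), UNPAID (FLOOR G unmet); RULES K-R59 and K-R60 (i)–(iv) FIXED; PORT GO» — kernel re-verified by the critic (farm rc 0 · 0 errors · 0 sorries; 207 decls = 173 theorems + 34 defs; axioms standard re-probed on 27 heads), record: piece C227 «HeightComparison ⟸ SiegelFunctionsAll», the K-line binder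 HeightComparison henceforth CONSUMED through heightComparison_of_siegelFunctionsAll (Dom re-pointing BY NAME, antecedent count unchanged), 𝒞₃ / InC3 decided hypothesis-free by thinFibreAt_of_inC3 / thinFibreAt_two_sqLinP = the K-R60 (i) kernel shape (TOOLKIT, ×0, never payable), tally UNCHANGED lens-1 ×22 + THEOREM ×24, EXHIBITS ρ1 / ρ2 VACANT, 33364 / 33363 / 31077 / 31987 OPEN rung 0. Port by census-1 gen 26 as `RootDecomp1KSiegelFunctions01–09` (files ≤ 400 lines; chain 01 ← the three K imports, 0k ← 0(k−1); `--supports stmt-Schanuel-33364`, the item stays OPEN; ×0 record port — the geometric binder `SiegelFunctions` / `SiegelFunctionsAll` appears ONLY as an explicit hypothesis of the `…_of_siegelFunctions…` heads, never an axiom / instance / variable; no credit anywhere; the section-aligned 9-part split is lens-1's port plan (J7) re-built by the census pipeline): 01 = K-port l.1–216 (§0 / §1) — 25 decls `ratModel`, `QDvd`, `relPoly`, …, `evalEval_ratModel_relPoly`; 02 = K-port l.219–450 (§2) — 20 decls `scaledEval`, `l1`, `l1_nonneg`, …, `abs_le_of_rel`; 03 = K-port l.453–658 (§3 / §4) — 9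 decls `HtQ_pow`, `logHt_pow`, `HtQ_intDiv_le`, …, `upperComparisonAt_of_siegelFunctions`; 04 = K-port l.661–830 (§5) — 13 decls `coeff_coeff_swap`, `map_swap`, `natDegree_swap`, …, `heightComparison_of_siegelFunctions`; 05 = K-port l.833–1109 (§6 / §7) — 28 decls `thinFibreAt_of_heightComparisonAt`, `thinFibreAt_of_heightComparison'`, `thinFibreAt_of_siegelFunctions`, …, `siegelFunctions_toys`; 06 = K-port l.1111–1304 (§8) — 20 decls `sqLinP`, `sqLinP_eq`, `natDegree_sqLinP`, …, `thinFibreAt_sqLinP_of_swap`; 07 = K-port l.1306–1551 (§9) — 35 decls `compM`, `cubic`, `cubic_eq`, …, `natDegree_det3_compM_pow_le`; 08 = K-port l.1553–1860 (§10) — 40 decls `q₃`, `q₂`, `q₁`, …, `heightComparisonAt_sqLinP_of_geomIrreducible`; 09 = K-port l.1862–2078 (§11 / §12) — 17 decls `sqLinK`, `coeff_sqLinK`, `natDegree_sqLinK`, …, `thinFibreAt_of_inC3`. 91 one-line docstrings synthesised for undocumented helper declarations (statements quoted); TWO port-side modifiers of record: `sum_Icc_half_pow` (§2, part 02) is `private`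 with a PORT NOTE after the `dedup.landed` bounce p850627 (≡ `Literature.Computability.Cryptography.HashDom.sum_Icc_half_pow`), and the consistency check `thinFibreAt_of_heightComparison'` (§6, part 05) is `private` with a PORT NOTE after the `dedup.landed` bounce p850703 (≡ node 12's `RootDecomp1KHeightGrading.thinFibreAt_of_heightComparison`, the intended identity); everything else = K VERBATIM (statements, names, proofs, K's module docstring kept in part 01 below this provenance block).)
-/

noncomputable section

namespace Summit.Schanuel.Schanuel.Theorems.RootDecomp1KSiegelFunctions

open Polynomial
open scoped Nat
open Summit.Schanuel.Schanuel.Theorems.RootDecomp1KDegreeLadder (bev xdeg natDegree_coeff_le_xdeg ThinFibreAt ThinFibre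
  thinFibreAt_of_natDegree_lt)
open Summit.Schanuel.Schanuel.Theorems.RootDecomp1KHeightGrading

/-! ### §6  RE-POINTING node 12 BY NAME (bookkeeping, ×0 — said so): THEOREM A localised to one curve, the K-line heads
hung on `SiegelFunctionsAll`, the member `H17P` -/

/-- **THEOREM A LOCALISED** (node 12's `thinFibreAt_of_heightComparison`, same proof, the binder consumed AT `P` ONLY):
`HeightComparisonAt P → 1 ≤ xdeg P → deg_Y P < m₀·xdeg P → ThinFibreAt m₀ P` — so that a PARTIAL discharge of the
geometric half (Siegel functions on ONE curve and its transpose) decides that member unconditionally. -/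
theorem thinFibreAt_of_heightComparisonAt {P : ℤ[X][X]} (hH : HeightComparisonAt P) (hk : 1 ≤ xdeg P) {m₀ : ℕ}
    (hlt : P.natDegree < m₀ * xdeg P) : ThinFibreAt m₀ P := by
  have hm : 1 ≤ m₀ := by
    rcases Nat.eq_zero_or_pos m₀ with h0 | h0
    · subst h0; simp at hlt
    · exact h0
  by_cases hn : P.natDegree = 0
  · exact thinFibreAt_of_natDegree_lt (by rw [hn]; exact hm)
  have hn1 : 1 ≤ P.natDegree := Nat.one_le_iff_ne_zero.mpr hn
  obtain ⟨hε, hε1⟩ := eps_pos_le_one hm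
  obtain ⟨c, hc⟩ := hH _ hε
  intro C
  obtain ⟨N₀, hN₀⟩ := clause_of_lower_height (n := P.natDegree) (k := xdeg P) (m₀ := m₀) hn1 hlt c C
  refine ⟨max N₀ 2, fun N hN r hrC hroot _ => ?_⟩
  have hNN₀ : N₀ ≤ N := le_trans (le_max_left _ _) hN
  have hN2 : 2 ≤ N := le_trans (le_max_right _ _) hN
  have hx : bev P ((xQ N : ℚ) : ℝ) (r : ℝ) = 0 := by rw [xQ_cast]; exact hroot
  have hb := hc (xQ N) r hx
  have hlow := le_logHt_xQ hN2
  have hr := logHt_le_of_abs_le hrC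
  refine hN₀ N hNN₀ r.den r.den_pos ?_
  have hk1 : (1 : ℝ) ≤ xdeg P := by exact_mod_cast hk
  have e1 : (xdeg P : ℝ) * logHt (xQ N) - (P.natDegree : ℝ) * logHt r ≤ 1 / (2 * (m₀ : ℝ)) * logHt (xQ N) + c :=
    (le_abs_self _).trans hb
  have e4 : ((xdeg P : ℝ) - 1 / (2 * m₀)) * ((N ! : ℝ) * Real.log 2) ≤
      ((xdeg P : ℝ) - 1 / (2 * m₀)) * logHt (xQ N) := mul_le_mul_of_nonneg_left hlow (by linarith)
  have e5 : (P.natDegree : ℝ) * logHt r ≤ (P.natDegree : ℝ) * (Real.log (max C 1) + Real.log (r.den : ℝ)) :=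
    mul_le_mul_of_nonneg_left hr (by positivity)
  have e6 : ((xdeg P : ℝ) - 1 / (2 * m₀)) * logHt (xQ N) =
      (xdeg P : ℝ) * logHt (xQ N) - 1 / (2 * (m₀ : ℝ)) * logHt (xQ N) := by ring
  linarith

/-- node 12's global THEOREM A IS the localised one composed with `heightComparison_iff` (consistency check).
(PORT NOTE, census-1 g26: PRIVATE — the statement is identical to node 12's own tree theorem
`RootDecomp1KHeightGrading.thinFibreAt_of_heightComparison` (RootDecomp1KHeightGrading02 l.42, inside this file's import closure), which is
the point of the consistency check; the gate's `dedup.landed` lint forbids a public restatement (bounce p850703 of the first filing of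
part 05); K's statement and proof are kept verbatim under `private`, still kernel-checked (precedents p848905 / p850098 / p850627).) -/
private theorem thinFibreAt_of_heightComparison' (hH : HeightComparison) {P : ℤ[X][X]} (hgi : GeomIrreducible P)
    (hk : 1 ≤ xdeg P) {m₀ : ℕ} (hlt : P.natDegree < m₀ * xdeg P) : ThinFibreAt m₀ P := by
  by_cases hn : P.natDegree = 0
  · have hm : 1 ≤ m₀ := by
      rcases Nat.eq_zero_or_pos m₀ with h0 | h0
      · subst h0; simp at hlt
      · exact h0
    exact thinFibreAt_of_natDegree_lt (by rw [hn]; exact hm)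
  · exact thinFibreAt_of_heightComparisonAt (hH P hgi hk (Nat.one_le_iff_ne_zero.mpr hn)) hk hlt

/-- **ONE MEMBER FROM ITS OWN SIEGEL FUNCTIONS**: Siegel functions on `P` and on its transpose decide the thin-fibre
clause at every `m₀` with `deg_Y P < m₀ · xdeg P`, for `P` geometrically irreducible — NO global binder. -/
theorem thinFibreAt_of_siegelFunctions {P : ℤ[X][X]} (hgi : GeomIrreducible P) (hk : 1 ≤ xdeg P)
    (hS : SiegelFunctions P) (hS' : SiegelFunctions (Bivariate.swap P)) {m₀ : ℕ}
    (hlt : P.natDegree < m₀ * xdeg P) : ThinFibreAt m₀ P := by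
  by_cases hn : P.natDegree = 0
  · have hm : 1 ≤ m₀ := by
      rcases Nat.eq_zero_or_pos m₀ with h0 | h0
      · subst h0; simp at hlt
      · exact h0
    exact thinFibreAt_of_natDegree_lt (by rw [hn]; exact hm)
  · exact thinFibreAt_of_heightComparisonAt
      (heightComparisonAt_of_siegelFunctions hgi hk (Nat.one_le_iff_ne_zero.mpr hn) hS hS') hk hlt

/-- node 12's THEOREM A/B pair re-pointed: modulo `SiegelFunctionsAll`. -/
theorem thinFibreAt_grading_of_siegelFunctionsAll (h : SiegelFunctionsAll) {P : ℤ[X][X]} (hgi : GeomIrreducible P)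
    (hk : 1 ≤ xdeg P) {m₀ : ℕ} (hm : 1 ≤ m₀) :
    (P.natDegree < m₀ * xdeg P → ThinFibreAt m₀ P) ∧
      (m₀ * xdeg P < P.natDegree → (ThinFibreAt m₀ P ↔ BddLevelEmpty P)) :=
  thinFibreAt_grading (heightComparison_of_siegelFunctionsAll h) hgi hk hm

/-- the K-line head of record re-pointed: `ThinFibre m₀ ⟸ PadicSubspace ∧ SiegelFunctionsAll ∧ HeightOffAt m₀`. -/
theorem thinFibre_of_padicSubspace_siegelFunctionsAll {m₀ : ℕ} (hm : 2 ≤ m₀)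
    (hS : Summit.Schanuel.Schanuel.Theorems.RootDecomp1KSubspaceBranch.PadicSubspace) (h : SiegelFunctionsAll)
    (hR : HeightOffAt m₀) : ThinFibre m₀ :=
  thinFibre_of_padicSubspace_heightComparison hm hS (heightComparison_of_siegelFunctionsAll h) hR

/-- … and its (b)-form. -/
theorem b_of_padicSubspace_siegelFunctionsAll {m₀ : ℕ} (hm : 2 ≤ m₀)
    (hS : Summit.Schanuel.Schanuel.Theorems.RootDecomp1KSubspaceBranch.PadicSubspace) (h : SiegelFunctionsAll)
    (hR : HeightOffAt m₀) (ρ : ℝ) (hρ : Summit.Schanuel.Schanuel.Theorems.RootDecomp1KSkelCell.SkelLiouvilleFix m₀ ρ) :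
    AlgebraicIndependent ℚ ![((liouvilleNumber 2 : ℝ) : ℂ), (ρ : ℂ)] :=
  b_of_padicSubspace_heightComparison hm hS (heightComparison_of_siegelFunctionsAll h) hR ρ hρ

/-- THE MEMBER `H17P` (node 12 §6) re-pointed to ITS OWN Siegel functions: `ThinFibreAt m₀ H17P` for `m₀ ≥ 2` from
`SiegelFunctions H17P ∧ SiegelFunctions (swap H17P)` — no global binder (and, HONESTY, weaker than the tree's
hypothesis-free `RootDecomp1KIntegrality.thinFibreAt_H17P_all`; recorded as the re-pointing pattern only). -/
theorem thinFibreAt_H17P_of_siegelFunctions (hS : SiegelFunctions H17P) (hS' : SiegelFunctions (Bivariate.swap H17P))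
    {m₀ : ℕ} (hm : 2 ≤ m₀) : ThinFibreAt m₀ H17P :=
  thinFibreAt_of_siegelFunctions geomIrreducible_H17P (by rw [xdeg_H17P]; norm_num) hS hS'
    (by rw [natDegree_H17P, xdeg_H17P]; omega)

/-! ### §7  SATISFIABILITY PROBES: the typed `∃` of `SiegelFunctions` PROVED BY HAND on three explicit curves of
different shape — the parabola `Y² − x` (φ = 1, ψ = Y^b, relation `T² − x^b`, `a = ⌈b/2⌉`, `c = 1`), its transpose
`x² − Y` (relation `T − x^{2b}`, `a = 2b`, `c = 0`), and the NON-DOMINANT hyperbola `x·Y − 1` (φ = x^b, ψ ≡ 1,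
`a = b`, `c = 0`) -/

/-- `{P : ℤ[X][X]} {d : ℕ} (h : ∀ j, (P.coeff j).natDegree ≤ d) : xdeg P ≤ d`. -/
theorem xdeg_le_of_coeff {P : ℤ[X][X]} {d : ℕ} (h : ∀ j, (P.coeff j).natDegree ≤ d) : xdeg P ≤ d := by
  unfold xdeg; exact Finset.sup_le fun j _ => h j

/-- `(D : ℤ) (χ : ℕ → ℤ[X]) (G H : ℤ[X][X]) : relPoly 1 D χ G H = C (C D) * G + C (χ 1) * H`. -/
theorem relPoly_one (D : ℤ) (χ : ℕ → ℤ[X]) (G H : ℤ[X][X]) : relPoly 1 D χ G H = C (C D) * G + C (χ 1) * H := by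
  simp [relPoly]

/-- `: Finset.Icc 1 2 = ({1, 2} : Finset ℕ)`. -/
theorem Icc_one_two : Finset.Icc 1 2 = ({1, 2} : Finset ℕ) := by
  ext i; simp only [Finset.mem_Icc, Finset.mem_insert, Finset.mem_singleton]; omega

/-- `(D : ℤ) (χ : ℕ → ℤ[X]) (G H : ℤ[X][X]) : relPoly 2 D χ G H = C (C D) * G ^ 2 + C (χ 1) * G * H + C (χ 2) * H ^ 2`. -/
theorem relPoly_two (D : ℤ) (χ : ℕ → ℤ[X]) (G H : ℤ[X][X]) :
    relPoly 2 D χ G H = C (C D) * G ^ 2 + C (χ 1) * G * H + C (χ 2) * H ^ 2 := by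
  rw [relPoly, Icc_one_two, Finset.sum_insert (by simp), Finset.sum_singleton]
  simp only [Nat.sub_self, pow_zero, pow_one, mul_one, show 2 - 1 = 1 from rfl]
  ring

/-- a curve of positive `Y`-degree divides no nonzero `Y`-constant over `ℚ` (in particular it is not a unit). -/
theorem not_qdvd_C {P : ℤ[X][X]} (hn : 1 ≤ P.natDegree) {q : ℤ[X]} (hq : q ≠ 0) : ¬ QDvd P (C q) := by
  intro h
  rw [QDvd, ratModel_C] at h
  have hq' : (C (q.map (Int.castRingHom ℚ)) : ℚ[X][X]) ≠ 0 := by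
    rw [Ne, C_eq_zero, Polynomial.map_eq_zero_iff (Int.castRingHom ℚ).injective_int]
    exact hq
  have h1 := natDegree_le_of_dvd h hq'
  rw [natDegree_C, ratModel, natDegree_map_eq_of_injective (map_injective _ (Int.castRingHom ℚ).injective_int)] at h1
  omega

/-- `{P : ℤ[X][X]} (hn : 1 ≤ P.natDegree) : ¬ QDvd P 1`. -/
theorem not_qdvd_one {P : ℤ[X][X]} (hn : 1 ≤ P.natDegree) : ¬ QDvd P 1 := by
  rw [← C_1]; exact not_qdvd_C hn one_ne_zero

/-- `φ = G/1` with `G = C q`, `q ∈ ℤ[x]` of degree `≤ a`, is integral of degree `≤ a` (relation `T − q`). -/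
theorem integralOfDegree_C (P : ℤ[X][X]) {a : ℕ} {q : ℤ[X]} (hq : q.natDegree ≤ a) :
    IntegralOfDegree P a (C q) 1 := by
  refine ⟨1, 1, fun i => if i = 0 then 0 else -q, one_ne_zero, fun i => ?_, ?_⟩
  · dsimp only
    split_ifs with h
    · simp
    · rw [natDegree_neg]; exact hq.trans (Nat.le_mul_of_pos_right _ (Nat.pos_of_ne_zero h))
  · have h0 : relPoly 1 1 (fun i => if i = 0 then 0 else -q) (C q) 1 = 0 := by
      rw [relPoly_one]; simp
    unfold QDvd
    rw [h0, ratModel_zero]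
    exact dvd_zero _

/-- [toy 1] the parabola `Y² − x`. -/
def parabP : ℤ[X][X] := X ^ 2 - C X

/-- `: parabP.natDegree = 2`. -/
theorem natDegree_parabP : parabP.natDegree = 2 := by
  rw [parabP, natDegree_sub_eq_left_of_natDegree_lt] <;> rw [natDegree_X_pow]
  rw [natDegree_C]; norm_num

/-- `: xdeg parabP = 1`. -/
theorem xdeg_parabP : xdeg parabP = 1 := by
  apply le_antisymm
  · refine xdeg_le_of_coeff fun j => ?_
    rw [parabP, coeff_sub]
    refine (natDegree_sub_le _ _).trans (max_le ?_ ?_)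
    · rw [coeff_X_pow]; split_ifs <;> simp
    · rw [coeff_C]; split_ifs <;> simp
  · have h := natDegree_coeff_le_xdeg parabP 0
    have e : parabP.coeff 0 = -X := by simp [parabP, coeff_X_pow]
    rwa [e, natDegree_neg, natDegree_X] at h

/-- **`SiegelFunctions (Y² − x)` PROVED** (`c = 1`; for `b ≥ 1`: `a = ⌈b/2⌉`, `φ = 1`, `ψ = Y^b` with the relation
`T² − x^b ≡ 0 mod (Y² − x)`). -/
theorem siegelFunctions_parabP : SiegelFunctions parabP := by
  have hn : 1 ≤ parabP.natDegree := by rw [natDegree_parabP]; norm_num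
  refine ⟨1, fun b hb => ⟨(b + 1) / 2, 1, 1, ?_, not_qdvd_one hn, not_qdvd_one hn, ?_, ?_⟩⟩
  · rw [natDegree_parabP, xdeg_parabP]; omega
  · simpa using integralOfDegree_C parabP (q := 1) (a := (b + 1) / 2) (by simp)
  · refine ⟨2, 1, fun i => if i = 2 then -X ^ b else 0, one_ne_zero, fun i => ?_, ?_⟩
    · dsimp only
      split_ifs with h
      · subst h; rw [natDegree_neg, natDegree_X_pow]; omega
      · simp
    · have hrel : relPoly 2 1 (fun i => if i = 2 then -X ^ b else 0) (1 * X ^ b) 1 = (X ^ 2) ^ b - C X ^ b := by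
        rw [relPoly_two]; simp; ring
      unfold QDvd
      rw [hrel]
      simp only [parabP, ratModel_sub, ratModel_pow, ratModel_X, ratModel_C, Polynomial.map_X]
      exact sub_dvd_pow_sub_pow _ _ b

/-- [toy 2] the transposed parabola `x² − Y` (`= swap parabP`). -/
def parabP' : ℤ[X][X] := C (X ^ 2) - X

/-- `: Bivariate.swap parabP = parabP'`. -/
theorem swap_parabP : Bivariate.swap parabP = parabP' := by
  rw [parabP, parabP', map_sub, map_pow, Bivariate.swap_X, Bivariate.swap_Y, map_pow]

/-- `: parabP'.natDegree = 1`. -/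
theorem natDegree_parabP' : parabP'.natDegree = 1 := by
  rw [parabP', natDegree_sub_eq_right_of_natDegree_lt] <;> rw [natDegree_X]
  rw [natDegree_C]; norm_num

/-- `: xdeg parabP' = 2`. -/
theorem xdeg_parabP' : xdeg parabP' = 2 := by
  apply le_antisymm
  · refine xdeg_le_of_coeff fun j => ?_
    rw [parabP', coeff_sub]
    refine (natDegree_sub_le _ _).trans (max_le ?_ ?_)
    · rw [coeff_C]; split_ifs <;> simp
    · rw [coeff_X]; split_ifs <;> simp
  · have h := natDegree_coeff_le_xdeg parabP' 0
    have e : parabP'.coeff 0 = X ^ 2 := by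
      rw [parabP', coeff_sub, coeff_C_zero, coeff_X_zero, sub_zero]
    rwa [e, natDegree_X_pow] at h

/-- **`SiegelFunctions (x² − Y)` PROVED** (`c = 0`; for `b ≥ 1`: `a = 2b`, `φ = 1`, `ψ = Y^b`, relation `T − x^{2b}`). -/
theorem siegelFunctions_parabP' : SiegelFunctions parabP' := by
  have hn : 1 ≤ parabP'.natDegree := by rw [natDegree_parabP']
  refine ⟨0, fun b hb => ⟨2 * b, 1, 1, ?_, not_qdvd_one hn, not_qdvd_one hn, ?_, ?_⟩⟩
  · rw [natDegree_parabP', xdeg_parabP']; omega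
  · simpa using integralOfDegree_C parabP' (q := 1) (a := 2 * b) (by simp)
  · refine ⟨1, 1, fun i => if i = 0 then 0 else -X ^ (2 * b), one_ne_zero, fun i => ?_, ?_⟩
    · dsimp only
      split_ifs with h
      · simp
      · rw [natDegree_neg, natDegree_X_pow]
        exact Nat.le_mul_of_pos_right _ (Nat.pos_of_ne_zero h)
    · have hrel : relPoly 1 1 (fun i => if i = 0 then 0 else -X ^ (2 * b)) (1 * X ^ b) 1 =
          X ^ b - C (X ^ 2) ^ b := by
        rw [relPoly_one]; simp; ring
      unfold QDvd
      rw [hrel]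
      simp only [parabP', ratModel_sub, ratModel_pow, ratModel_X, ratModel_C, Polynomial.map_X, Polynomial.map_pow]
      rw [show (C (X ^ 2) : ℚ[X][X]) - X = -(X - C (X ^ 2)) from (neg_sub _ _).symm]
      exact (sub_dvd_pow_sub_pow _ _ b).neg_left

/-- [toy 3] the hyperbola `x·Y − 1` — NON-DOMINANT (`Y`-leading coefficient `x`): `y = 1/x` has a pole at the finite
place `x = 0`, harmless for Siegel functions. -/
def hyperbP : ℤ[X][X] := C X * X - 1

/-- `: hyperbP.natDegree = 1`. -/
theorem natDegree_hyperbP : hyperbP.natDegree = 1 := by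
  have h1 : (C X * X : ℤ[X][X]).natDegree = 1 := natDegree_C_mul_X _ X_ne_zero
  rw [hyperbP, natDegree_sub_eq_left_of_natDegree_lt] <;> rw [h1]
  simp

/-- `: xdeg hyperbP = 1`. -/
theorem xdeg_hyperbP : xdeg hyperbP = 1 := by
  apply le_antisymm
  · refine xdeg_le_of_coeff fun j => ?_
    rw [hyperbP, coeff_sub]
    refine (natDegree_sub_le _ _).trans (max_le ?_ ?_)
    · rw [coeff_C_mul_X]; split_ifs <;> simp
    · rw [coeff_one]; split_ifs <;> simp
  · have h := natDegree_coeff_le_xdeg hyperbP 1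
    have e : hyperbP.coeff 1 = X := by
      rw [hyperbP, coeff_sub, coeff_C_mul_X, if_pos rfl, coeff_one, if_neg (by norm_num), sub_zero]
    rwa [e, natDegree_X] at h

/-- **`SiegelFunctions (x·Y − 1)` PROVED** (`c = 0`; for `b ≥ 1`: `a = b`, `φ = x^b` (relation `T − x^b`),
`ψ = x^b·Y^b ≡ 1` (relation `T − 1`, since `(xY)^b − 1 ≡ 0 mod (xY − 1)`)). -/
theorem siegelFunctions_hyperbP : SiegelFunctions hyperbP := by
  have hn : 1 ≤ hyperbP.natDegree := by rw [natDegree_hyperbP]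
  refine ⟨0, fun b hb => ⟨b, C (X ^ b), 1, ?_, not_qdvd_C hn (pow_ne_zero b X_ne_zero), not_qdvd_one hn,
    integralOfDegree_C hyperbP (by rw [natDegree_X_pow]), ?_⟩⟩
  · rw [natDegree_hyperbP, xdeg_hyperbP]; omega
  · refine ⟨1, 1, fun _ => -1, one_ne_zero, fun i => by simp, ?_⟩
    have hrel : relPoly 1 1 (fun _ => -1) (C (X ^ b) * X ^ b) 1 = (C X * X) ^ b - 1 ^ b := by
      rw [relPoly_one]; simp; ring
    unfold QDvd
    rw [hrel]
    simp only [hyperbP, ratModel_sub, ratModel_pow, ratModel_mul, ratModel_X, ratModel_C, ratModel_one,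
      Polynomial.map_X]
    exact sub_dvd_pow_sub_pow _ _ b

/-- HONESTY: the three probes are SATISFIABILITY checks of the typed `∃` (the relation really is demanded for BOTH `φ`
and `φ·Y^b`, the degree budget `a·deg_Y P ≤ b·xdeg P + c` really is met with the genus-type constant `c`); all three
curves are rational and long decided in the tree — they earn nothing (critic K-R59 (ii)). -/
theorem siegelFunctions_toys : SiegelFunctions parabP ∧ SiegelFunctions parabP' ∧ SiegelFunctions hyperbP :=
  ⟨siegelFunctions_parabP, siegelFunctions_parabP', siegelFunctions_hyperbP⟩

end Summit.Schanuel.Schanuel.Theorems.RootDecomp1KSiegelFunctions
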